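import Mathlib
import Literature.NumberTheory.EllipticCurves.EisensteinCongruence

/-!
# `p`-adic integrality of the `q`-expansion of `E_{p-1}` (stub `stub_eisensteinCoeff`)

Line `Sketch-ideate-r1-k1` for the crux `HilbertIntegralOverconvergentIsCongruence`
(item stmt-Langlands-8485, route `CapacityClassicality`), registered stub 2.

For a prime `p ≥ 5` and any ring isomorphism `ι : ℚ̄_p ≃+* ℂ` (`ℚ̄_p = PadicAlgCl p`), every
coefficient `aₙ` of the `q`-expansion of the normalised level-one Eisenstein series `E_{p-1}`
(Mathlib `ModularForm.E`) satisfies `‖ι⁻¹(aₙ)‖ ≤ 1`.  Indeed `a₀ = 1` and, for `n ≠ 0`,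
`aₙ = -(2(p-1)/B_{p-1}) σ_{p-2}(n)` (Mathlib `EisensteinSeries.E_qExpansion_coeff`) is a rational
number of `p`-adic valuation `< 1`, because `v_p(B_{p-1}) = -1` by von Staudt–Clausen (Mathlib
`Bernoulli.vonStaudt_clausen`); this is the tree's Deligne–Serre 6.9 file
`Literature.NumberTheory.EllipticCurves.ModularForms.DeligneSerre1974.eisenstein_qExpansion_congr_one`
(fully proved) specialised to `ℓ = p`, `k = p - 1`.  A ring isomorphism fixes `ℚ`, and the norm of
`PadicAlgCl p` extends the `p`-adic norm of `ℚ_[p]` (`PadicAlgCl.norm_extends`,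
`Padic.norm_rat_le_one_iff_padicValuation_le_one`).

No new definitions, no named facts: everything is proved from Mathlib and the (proved) Literature
file above.
-/

noncomputable section

set_option linter.dupNamespace false -- `Summit.Langlands.Langlands` is the mandated namespace

namespace Summit.Langlands.Langlands.Theorems.HilbertIntegralOverconvergentIsCongruence

/-- A `p`-integral rational `r` (`Rat.padicValuation p r ≤ 1`) is a `p`-adic integer of `ℚ̄_p`
when read through any ring isomorphism `ι : ℚ̄_p ≃+* ℂ`: `ι⁻¹(r) = r` and
`‖r‖_{ℚ̄_p} = ‖r‖_{ℚ_p} ≤ 1`. [folklore] -/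
theorem norm_ringEquiv_symm_ratCast_le_one {p : ℕ} [Fact p.Prime] (ι : PadicAlgCl p ≃+* ℂ)
    {r : ℚ} (hr : Rat.padicValuation p r ≤ 1) : ‖ι.symm (r : ℂ)‖ ≤ 1 := by
  rw [map_ratCast, show ((r : PadicAlgCl p)) = ((r : ℚ_[p]) : PadicAlgCl p) by
      rw [map_ratCast (algebraMap ℚ_[p] (PadicAlgCl p))], PadicAlgCl.norm_extends]
  exact (Padic.norm_rat_le_one_iff_padicValuation_le_one p).2 hr

/-- **Stub `stub_eisensteinCoeff`.**  For a prime `p ≥ 5`, a ring isomorphism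
`ι : ℚ̄_p ≃+* ℂ` and every `n`, the `n`-th coefficient of the `q`-expansion (at the cusp `∞`,
width `1`) of the normalised level-one Eisenstein series `E_{p-1}`, pulled back along `ι`, has
norm `≤ 1` in `PadicAlgCl p`; i.e. the `q`-expansion of `E_{p-1}` is `p`-adically integral
(`a₀ = 1`, `aₙ = -(2(p-1)/B_{p-1}) σ_{p-2}(n)` with `v_p(B_{p-1}) = -1`, von Staudt–Clausen).
[folklore] -/
theorem stub_eisensteinCoeff :
    ∀ (p : ℕ) [Fact p.Prime] (hp : 5 ≤ p) (ι : PadicAlgCl p ≃+* ℂ) (n : ℕ),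
      ‖ι.symm (PowerSeries.coeff n
        (UpperHalfPlane.qExpansion 1 ⇑(ModularForm.E (show 3 ≤ p - 1 by omega))))‖ ≤ 1 := by
  intro p _ hp ι n
  have hprime : p.Prime := Fact.out
  have heven : Even (p - 1) := hprime.even_sub_one (by omega)
  obtain ⟨h0, hm⟩ :=
    Literature.NumberTheory.EllipticCurves.ModularForms.DeligneSerre1974.eisenstein_qExpansion_congr_one
      (ℓ := p) (show 3 ≤ p - 1 by omega) heven dvd_rfl
  rcases eq_or_ne n 0 with rfl | hn
  · rw [h0, map_one, norm_one]
  · obtain ⟨r, hr, hcoeff⟩ := hm n hn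
    rw [hcoeff]
    exact norm_ringEquiv_symm_ratCast_le_one ι hr.le

end Summit.Langlands.Langlands.Theorems.HilbertIntegralOverconvergentIsCongruence

end
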